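import Mathlib.Analysis.SpecialFunctions.Pow.Real
import Mathlib.Topology.Order.Compact
import Mathlib.Topology.MetricSpace.Pseudo.Defs

/-!
# Crux `PerpetualPump.AveragedTypeIBlowup` (stmt-NavierStokesRegularity-1835), line `Sketch`:
# generic tools of the composition `stub_threshold` (lead c1)

Dependent recursion along certified steps, the canonical value function of a family of solutions with
uniqueness, sup-of-image bounds for the renormalised amplitudes, the pace of the staircase (telescoping
geometric durations and the blow-up time), and the weight-growth contradiction behind non-extendability.
-/

noncomputable section
set_option linter.dupNamespace false

open Set

namespace Summit.NavierStokesRegularity.NavierStokesRegularity.Theorems.PerpetualPumpAveragedTypeIBlowup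

/-- **Dependent recursion**: from a level-indexed invariant `G` that can always be advanced (with a link
`L` to the next state) and an initial state, an infinite chain. [folklore] -/
theorem threshold_recursion {D : Type*} (G : ℕ → D → Prop) (L : ℕ → D → D → Prop) (d₀ : D) (h₀ : G 0 d₀)
    (hstep : ∀ (k : ℕ) (d : D), G k d → ∃ d' : D, G (k + 1) d' ∧ L k d d') :
    ∃ f : ℕ → D, f 0 = d₀ ∧ ∀ k : ℕ, G k (f k) ∧ L k (f k) (f (k + 1)) := by
  choose next hG hL using hstep
  let seqT : (k : ℕ) → {d : D // G k d} := fun k =>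
    Nat.rec (motive := fun k => {d : D // G k d}) ⟨d₀, h₀⟩ (fun k ih => ⟨next k ih.1 ih.2, hG k ih.1 ih.2⟩) k
  exact ⟨fun k => (seqT k).1, rfl, fun k => ⟨(seqT k).2, hL k (seqT k).1 (seqT k).2⟩⟩

/-- **The canonical value function** of a family of solutions that agree wherever jointly defined
(apply with the lifespans `Ico 0 S`). [folklore] -/
theorem threshold_valueFunction {P Y : Type*} [Inhabited Y] (Sol : P → ℝ → (ℝ → Y) → Prop)
    (huniq : ∀ (A : P) (S₁ S₂ : ℝ) (Y₁ Y₂ : ℝ → Y), Sol A S₁ Y₁ → Sol A S₂ Y₂ → ∀ t ∈ Ico 0 (min S₁ S₂), Y₁ t = Y₂ t) :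
    ∃ val : P → ℝ → Y, ∀ (A : P) (S : ℝ) (Y₁ : ℝ → Y), Sol A S Y₁ → ∀ t ∈ Ico 0 S, val A t = Y₁ t := by
  classical
  refine ⟨fun A t => if h : ∃ S : ℝ, ∃ Y₁ : ℝ → Y, Sol A S Y₁ ∧ t < S then h.choose_spec.choose t else default,
    fun A S Y₁ hY t ht => ?_⟩
  have hex : ∃ S : ℝ, ∃ Y₂ : ℝ → Y, Sol A S Y₂ ∧ t < S := ⟨S, Y₁, hY, ht.2⟩
  simp only [dif_pos hex]
  obtain ⟨hS', ht'⟩ := hex.choose_spec.choose_spec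
  exact huniq A _ S _ Y₁ hS' hY t ⟨ht.1, lt_min ht' ht.2⟩

/-- **Sup of the image of a compact interval**: if `f` is continuous on `[a,b]`, takes the value `B` at
some point and is `≤ c` everywhere, then `sup f([a,b]) ∈ [B, c]`. [folklore] -/
theorem threshold_sSup_image_mem {f : ℝ → ℝ} {a b t₀ B c : ℝ} (hf : ContinuousOn f (Icc a b))
    (ht₀ : t₀ ∈ Icc a b) (hft₀ : f t₀ = B) (hle : ∀ t ∈ Icc a b, f t ≤ c) : sSup (f '' Icc a b) ∈ Icc B c := by
  have hbdd : BddAbove (f '' Icc a b) := (isCompact_Icc.image_of_continuousOn hf).bddAbove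
  refine ⟨le_csSup hbdd ⟨t₀, ht₀, hft₀⟩, csSup_le ⟨_, ⟨t₀, ht₀, rfl⟩⟩ ?_⟩
  rintro y ⟨t, ht, rfl⟩
  exact hle t ht

/-- **The pace of the staircase**: if the hand-off times advance by at most `4/R_k`, `R_k = D_c(1+ε₀)^{2k}`,
then they increase to a finite blow-up time `S` with the geometric tail `S − t_k ≤ C_d (1+ε₀)^{-2k}`,
`C_d = (4/D_c)/(1 − (1+ε₀)^{-2})`, every `t < S` is passed by some `t_k`, and `S` is the supremum of the
hand-off times. [folklore] -/
theorem threshold_pace {ts : ℕ → ℝ} {Dc ε₀ : ℝ} (hDc : 0 < Dc) (hε₀ : 0 < ε₀)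
    (hstep : ∀ k : ℕ, ts k < ts (k + 1) ∧ ts (k + 1) ≤ ts k + 4 / (Dc * (1 + ε₀) ^ (2 * k))) :
    0 < 4 / Dc / (1 - ((1 + ε₀) ^ 2)⁻¹) ∧ StrictMono ts ∧
    (∀ k : ℕ, ts k < sSup (Set.range fun k : ℕ => ts (k + 1))) ∧
    (∀ t : ℝ, t < sSup (Set.range fun k : ℕ => ts (k + 1)) → ∃ k : ℕ, t < ts k) ∧
    (∀ k : ℕ, sSup (Set.range fun k : ℕ => ts (k + 1)) - ts k ≤ 4 / Dc / (1 - ((1 + ε₀) ^ 2)⁻¹) * ((1 + ε₀) ^ (2 * k))⁻¹) := by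
  set ρ : ℝ := ((1 + ε₀) ^ 2)⁻¹ with hρ
  have hρ1 : ρ < 1 := inv_lt_one_of_one_lt₀ (by nlinarith)
  set Cd : ℝ := 4 / Dc / (1 - ρ) with hCd
  have hCd0 : 0 < Cd := div_pos (div_pos (by norm_num) hDc) (by linarith)
  set φ : ℕ → ℝ := fun k => Cd * ((1 + ε₀) ^ (2 * k))⁻¹ with hφ
  have hφ0 : ∀ k : ℕ, 0 ≤ φ k := fun k => by positivity
  have hφid : ∀ k : ℕ, 4 / (Dc * (1 + ε₀) ^ (2 * k)) = φ k - φ (k + 1) := fun k => by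
    have hx : (1 + ε₀) ^ (2 * (k + 1)) = (1 + ε₀) ^ (2 * k) * (1 + ε₀) ^ 2 := by rw [mul_add, mul_one, pow_add]
    have hxpos : 0 < (1 + ε₀) ^ (2 * k) := by positivity
    have h1ρ : 1 - ρ ≠ 0 := by linarith
    have h2 : (0:ℝ) < (1 + ε₀) ^ 2 := by positivity
    have hstep' : φ k - φ (k + 1) = Cd * ((1 + ε₀) ^ (2 * k))⁻¹ * (1 - ρ) := by
      simp only [hφ, hx, mul_inv, hρ]; ring
    rw [hstep', hCd]
    field_simp
  have hmono : StrictMono ts := strictMono_nat_of_lt_succ fun k => (hstep k).1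
  have hanti : Antitone fun k => ts k + φ k := antitone_nat_of_succ_le fun k => by
    have h1 := (hstep k).2
    have h2 := hφid k
    show ts (k + 1) + φ (k + 1) ≤ ts k + φ k
    linarith
  have hts_le : ∀ k m : ℕ, k ≤ m → ts m ≤ ts k + φ k := fun k m hkm => by
    have h' : ts m + φ m ≤ ts k + φ k := hanti hkm
    linarith [hφ0 m]
  set 𝒯 : Set ℝ := Set.range fun k : ℕ => ts (k + 1) with h𝒯
  have hne : 𝒯.Nonempty := ⟨_, 0, rfl⟩
  have hbdd : BddAbove 𝒯 := ⟨ts 0 + φ 0, by rintro _ ⟨k, rfl⟩; exact hts_le 0 (k + 1) (Nat.zero_le _)⟩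
  have hts_lt : ∀ k : ℕ, ts k < sSup 𝒯 := fun k => (hstep k).1.trans_le (le_csSup hbdd ⟨k, rfl⟩)
  refine ⟨hCd0, hmono, hts_lt, fun t ht => ?_, fun k => ?_⟩
  · obtain ⟨_, ⟨k, rfl⟩, hk⟩ := exists_lt_of_lt_csSup hne ht
    exact ⟨k + 1, hk⟩
  · have : sSup 𝒯 ≤ ts k + φ k := csSup_le hne (by
      rintro _ ⟨m, rfl⟩
      rcases le_or_gt k (m + 1) with h | h
      · exact hts_le k (m + 1) h
      · exact (hmono h).le.trans (le_add_of_nonneg_right (hφ0 k)))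
    simp only [hφ] at this
    linarith

/-- **The weight-growth contradiction**: amplitudes `B_k ≥ b_lo > 0` carried by coefficients `y_k` with
`|y_k|(1+ε₀)^{k/2} = B_k` are incompatible with a uniform bound `(1+ε₀)^{20k}|y_k| ≤ C`
(`(1+ε₀)^{39k/2} ≥ (1+ε₀)^k ≥ 1 + kε₀`). [folklore] -/
theorem threshold_growth_contra {ε₀ blo C : ℝ} {Bs y : ℕ → ℝ} (hε₀ : 0 < ε₀) (hblo : 0 < blo)
    (hB : ∀ k : ℕ, blo ≤ Bs k) (hy : ∀ k : ℕ, |y k| * (1 + ε₀) ^ (((k : ℤ) : ℝ) / 2) = Bs k)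
    (hC : ∀ k : ℕ, (1 + ε₀) ^ ((20 : ℝ) * (k : ℤ)) * |y k| ≤ C) : False := by
  have hL : (0:ℝ) < 1 + ε₀ := by linarith
  have hgrow : ∀ k : ℕ, blo * (1 + k * ε₀) ≤ C := fun k => by
    have hP : 0 < (1 + ε₀) ^ (((k : ℤ) : ℝ) / 2) := Real.rpow_pos_of_pos hL _
    have habs : |y k| = Bs k / (1 + ε₀) ^ (((k : ℤ) : ℝ) / 2) := by rw [eq_div_iff hP.ne']; exact hy k
    have hCk := hC k
    rw [habs] at hCk
    have hsplit : (1 + ε₀) ^ ((20 : ℝ) * (k : ℤ)) = (1 + ε₀) ^ (((k : ℤ) : ℝ) / 2) * (1 + ε₀) ^ ((39 / 2 : ℝ) * k) := by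
      rw [← Real.rpow_add hL]; push_cast; ring_nf
    have hge : (1 + ε₀) ^ (k : ℕ) ≤ (1 + ε₀) ^ ((39 / 2 : ℝ) * k) := by
      rw [← Real.rpow_natCast]
      exact Real.rpow_le_rpow_of_exponent_le (by linarith) (by nlinarith [k.cast_nonneg (α := ℝ)])
    have hbern : 1 + (k : ℝ) * ε₀ ≤ (1 + ε₀) ^ (k : ℕ) := one_add_mul_le_pow (by linarith) k
    have : (1 + ε₀) ^ ((20 : ℝ) * (k : ℤ)) * (Bs k / (1 + ε₀) ^ (((k : ℤ) : ℝ) / 2)) =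
        (1 + ε₀) ^ ((39 / 2 : ℝ) * k) * Bs k := by
      rw [hsplit]; field_simp
    rw [this] at hCk
    calc blo * (1 + k * ε₀) ≤ blo * (1 + ε₀) ^ ((39 / 2 : ℝ) * k) :=
          mul_le_mul_of_nonneg_left (hbern.trans hge) hblo.le
      _ ≤ (1 + ε₀) ^ ((39 / 2 : ℝ) * k) * Bs k := by
          rw [mul_comm]; exact mul_le_mul_of_nonneg_left (hB k) (by positivity)
      _ ≤ C := hCk
  obtain ⟨k, hk⟩ := exists_nat_gt (C / (blo * ε₀))
  have h1 := hgrow k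
  rw [div_lt_iff₀ (by positivity)] at hk
  nlinarith

/-- **Registered marker stub of this file** (`stub_thresholdTools`): Bernoulli's inequality in the form used
by the weight-growth contradiction. [folklore] -/
theorem stub_thresholdTools : ∀ (ε₀ : ℝ) (k : ℕ), 0 ≤ ε₀ → 1 + (k : ℝ) * ε₀ ≤ (1 + ε₀) ^ k :=
  fun _ k h => one_add_mul_le_pow (by linarith) k

end Summit.NavierStokesRegularity.NavierStokesRegularity.Theorems.PerpetualPumpAveragedTypeIBlowup

end
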